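import Summits.NavierStokesRegularity.FluidComputer.PalasekTowerHostFlow
import Summits.NavierStokesRegularity.FluidComputer.PalasekTowerHostLoop
import Summits.NavierStokesRegularity.FluidComputer.PalasekTowerRegisterGlobalBase
import Summits.NavierStokesRegularity.FluidComputer.PalasekTowerHeredityWitnessRungs
import Summits.NavierStokesRegularity.FunctionalMining.TopEigHeatMollifiedCeiling

/-!
# Host preparation, X: the circulation, the level-0 stage, and `RungG 0` (stub `host_preparation`)

Cell `ns-blowup`, seat `ns-blowup-ecbridge-3` (g0); GROUP C «BRIDGE SUPPORT» of the route
`PalasekTowerBreakdown` (crux `EpisodeBaseG`, item stmt-NavierStokesRegularity-19179). LABEL: E–C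
typing (KERNEL construction). WHAT THIS IS NOT: not Navier–Stokes evidence. This file INHABITS the
planner's BC3 stub `host_preparation` of the crux `EpisodeBaseG`, i.e. the tree Prop
`RungG 0` of `PalasekTowerRegisterGlobalTail.lean` — a pinned (`Λ = 8`, `θ = 6/5`), rigid, quiet
schedule on the wide-base rates carrying a GLOBALLY ANCHORED, strained, cored stage AT LEVEL `0` at
unit viscosity — by the PRESCRIBED host of `PalasekTowerHostFields` / `…Schedule` / `…Flow`: the
force is free before the first readout, so the level-`0` clauses are met by design (speed floor
`Y₀` first hit at `τ₀ = 1` by a quasi-static bump; strain floor `A₀` and core loop on the plateau of a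
cut-off strong-Beltrami packet of frequency `2N₀`; force `≤ Y₀/200` on the first window, `0` after).

HONEST NOTE (for the planner / the `first_episode` seat): the witness is JUNK with respect to
heredity — its designed continuation after `τ₀` is viscous decay, not growth to level `1`. It shows
that `RungG 0` as registered carries no dynamical content; every ∀-form stub at level `0`
(`HeredityAt 0`) has this host in its hypothesis class. It says nothing about `EpisodeBaseG`
(`RungG 1`).

* §1 the CIRCULATION of the host at `t = 1` around the core loop of `PalasekTowerHostLoop` (inside the
  slab's plateau, off the bump): the velocity there is `b₀λ • wave λ`, the integrand is
  `b₀λ · 2πr · sin θ · sin((π/2) sin θ) ≥ b₀λ · 2πr · sin² θ` (Jordan), so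
  `∮ ≥ b₀ λ π r = π² Y₀ / (8 N₀) ≥ Y₀ / N₀ = N₀^{β−2}` (`π² ≥ 8`);
* §2 the STAGE at level `0` for given scales (`stage_of_scales`), §3 the choice of scales from the
  existential packet/bump bounds, and **`rungG_zero : RungG 0`**.

References: S. Palasek, arXiv:2605.13827 §3.3–§4 [cite: Palasek2026ElementaryModel, §4];
A. J. Majda, A. L. Bertozzi, *Vorticity and Incompressible Flow* (CUP 2002), §1.7 (circulation),
§2.3.2 [cite: MajdaBertozziCUP2002, §2.3.2]; C. L. Fefferman, Clay problem description, (C)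
[cite: FeffermanClay2006, (C)].
-/

noncomputable section

namespace Summit.NavierStokesRegularity.FluidComputer.PalasekTowerClayBridge.Host

open Real Set Function Filter Topology InnerProductSpace Metric MeasureTheory intervalIntegral
open scoped RealInnerProductSpace ContDiff Topology ENNReal

open Literature.Analysis.FluidPDE

/-- Local notation for physical space `ℝ³ = EuclideanSpace ℝ (Fin 3)`. -/
local notation "ℝ³" => EuclideanSpace ℝ (Fin 3)

/-! ## §1 The circulation of the host around the core loop -/

/-- Every point of the loop is on the slab's plateau and off the bump (`L, L_b ≥ 1`). [folklore] -/
theorem loop_plateau {L Lb : ℝ} (hL : 1 ≤ L) (hLb : 1 ≤ Lb) (s : ℝ) :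
    (∀ᶠ y in 𝓝 (loop s), cutoff L y = 1) ∧ 2 * Lb < ‖loop s - center L Lb‖ := by
  have hr := norm_loop s
  refine ⟨eventually_cutoff_eq_one (by linarith) (by rw [hr]; linarith [loopRadius_lt_one]),
    far_from_center (by linarith) (by linarith) (by rw [hr]; linarith [loopRadius_lt_one])⟩

/-- **On the loop, at `t = 1`, the host IS the Beltrami wave**: `u(1, γ s) = b₀ λ • wave λ (γ s)`.
[folklore] -/
theorem vel_one_loop {L Lb : ℝ} (hL : 1 ≤ L) (hLb : 1 ≤ Lb) (s : ℝ) :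
    vel L Lb 1 (loop s) = (ampSlab * freq) • wave freq (loop s) := by
  obtain ⟨hpl, hfar⟩ := loop_plateau hL hLb s
  rw [vel_off_bump (by linarith) hfar, bProf_one, slab,
    packet_apply_of_plateau (differentiable_cutoff L) hpl, smul_smul]

/-- The circulation integrand in closed form. [folklore] -/
theorem circulation_integrand {L Lb : ℝ} (hL : 1 ≤ L) (hLb : 1 ≤ Lb) (s : ℝ) :
    ⟪vel L Lb 1 (loop s), deriv loop s⟫ =
      ampSlab * freq * (2 * π * loopRadius *
        (Real.sin (2 * π * s) * Real.sin (π / 2 * Real.sin (2 * π * s)))) := by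
  rw [vel_one_loop hL hLb, deriv_loop, real_inner_smul_left, inner_wave_loopVel]

/-- **Jordan's inequality, two-sided**: `v² ≤ v · sin((π/2) v)` for `|v| ≤ 1` (Mathlib
`Real.mul_le_sin`: `(2/π) x ≤ sin x` on `[0, π/2]`). [folklore] -/
private theorem sq_le_mul_sin {v : ℝ} (hv : |v| ≤ 1) : v ^ 2 ≤ v * Real.sin (π / 2 * v) := by
  have key : ∀ w : ℝ, 0 ≤ w → w ≤ 1 → w ≤ Real.sin (π / 2 * w) := by
    intro w hw0 hw1
    have h := Real.mul_le_sin (x := π / 2 * w) (by positivity)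
      (by nlinarith [Real.pi_pos])
    have e : 2 / π * (π / 2 * w) = w := by field_simp
    rwa [e] at h
  rcases le_or_gt 0 v with h | h
  · have := key v h (le_trans (le_abs_self v) hv)
    nlinarith
  · have h1 := key (-v) (by linarith) (le_trans (neg_le_abs v) hv)
    rw [mul_neg, Real.sin_neg] at h1
    nlinarith

/-- **THE CORE LEDGER INEQUALITY**: the circulation of `u(1)` around the loop is at least
`N₀^{β−2}` (`∮ ≥ b₀ λ π r = π² Y₀/2048 ≥ Y₀/256 = Y₀/N₀`). [cite: MajdaBertozziCUP2002, §2.3.2] -/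
theorem rpow_le_circulation {L Lb : ℝ} (hL : 1 ≤ L) (hLb : 1 ≤ Lb) :
    TowerRates.wide.N 0 ^ (TowerRates.wide.β - 2) ≤ circulation (vel L Lb 1) loop := by
  set K : ℝ := ampSlab * freq * (2 * π * loopRadius) with hK
  have hK0 : 0 ≤ K := by
    have := ampSlab_pos; have := freq_pos; have := loopRadius_pos; positivity
  have e : (fun s => ⟪vel L Lb 1 (loop s), deriv loop s⟫) =
      fun s => K * (Real.sin (2 * π * s) * Real.sin (π / 2 * Real.sin (2 * π * s))) := by
    funext s; rw [circulation_integrand hL hLb]; ring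
  have hlow : ∫ s in (0 : ℝ)..1, K * Real.sin (2 * π * s) ^ 2 ≤
      ∫ s in (0 : ℝ)..1, K * (Real.sin (2 * π * s) * Real.sin (π / 2 * Real.sin (2 * π * s))) := by
    refine intervalIntegral.integral_mono_on zero_le_one ?_ ?_ fun s _ => ?_
    · exact (by fun_prop : Continuous fun s : ℝ => K * Real.sin (2 * π * s) ^ 2).intervalIntegrable _ _
    · exact (by fun_prop : Continuous fun s : ℝ =>
        K * (Real.sin (2 * π * s) * Real.sin (π / 2 * Real.sin (2 * π * s)))).intervalIntegrable _ _
    · exact mul_le_mul_of_nonneg_left (sq_le_mul_sin (Real.abs_sin_le_one _)) hK0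
  have hval : ∫ s in (0 : ℝ)..1, K * Real.sin (2 * π * s) ^ 2 = K / 2 := by
    rw [intervalIntegral.integral_const_mul,
      Summit.NavierStokesRegularity.FunctionalMining.TopEigLaminate.integral_sin_two_pi_mul_sq]
    ring
  have hcirc : circulation (vel L Lb 1) loop =
      ∫ s in (0 : ℝ)..1, K * (Real.sin (2 * π * s) * Real.sin (π / 2 * Real.sin (2 * π * s))) := by
    rw [circulation, e]
  have hlow' : K / 2 ≤ circulation (vel L Lb 1) loop := by
    rw [hcirc, ← hval]; exact hlow
  refine le_trans ?_ hlow'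
  have hY := wide_Y_zero_pos
  have e2 : K / 2 = TowerRates.wide.Y 0 * (π * π / 2048) := by
    rw [hK, show ampSlab * freq * (2 * π * loopRadius) = (ampSlab * freq) * (2 * π * loopRadius) by
      ring, ampSlab_mul_freq, loopRadius, freq]
    field_simp
    ring
  rw [wide_rpow_β_sub_two, wide_N_zero, e2, div_eq_mul_one_div]
  refine mul_le_mul_of_nonneg_left ?_ hY.le
  nlinarith [Real.pi_gt_three]

/-! ## §2 The stage at level `0` for given scales -/

/-- **The level-`0` stage of the host schedule**, for scales `L, L_b ≥ 1` under the two quantitative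
hypotheses (slab speed `≤ (11/10)λ`; residual `≤ Y₀/200` on the first window): exact classical
forced Navier–Stokes on `[0, 1]` (an identity), zero datum, finite energy, the level-`0` floor /
ceiling, and the route margin `routeG` — strain floor `A₀` at the origin, the GLOBAL ANCHOR,
rigidity, and the core ledger on the loop. [cite: Palasek2026ElementaryModel, §4] -/
theorem stage_of_scales {L Lb : ℝ} (hL : 1 ≤ L) (hLb : 1 ≤ Lb)
    (hslab : ∀ x : ℝ³, ‖slab L x‖ ≤ 11 / 10 * freq)
    (hpush : ∀ t ∈ Icc (1 : ℝ) τfirst, ∀ x : ℝ³, ‖resid L Lb t x‖ ≤ 1 / 200 * TowerRates.wide.Y 0) :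
    Nonempty (Stage 1 TowerRates.wide (hostSchedule L Lb hL hLb hpush)
      (Margins.routeG TowerRates.wide) 0) := by
  have hL0 : 0 < L := by linarith
  have hLb0 : 0 < Lb := by linarith
  have hτ0 : (hostSchedule L Lb hL hLb hpush).τ 0 = 1 := hostSchedule_τ_zero hL hLb hpush
  have hrad : (hostSchedule L Lb hL hLb hpush).radius = radius L Lb := rfl
  have hrad0 : 0 ≤ radius L Lb := by show 0 ≤ 2 * L + 4 * Lb + 2; positivity
  have henergy : ∃ C : ℝ≥0∞, C < ⊤ ∧ ∀ t ∈ Icc 0 ((hostSchedule L Lb hL hLb hpush).τ 0),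
      ∫⁻ x, ‖vel L Lb t x‖ₑ ^ 2 ≤ C := by
    rw [hτ0]
    exact energy_vel hL0 hLb0 hslab
  have hcl : IsClassicalNSSolutionOn (Icc 0 ((hostSchedule L Lb hL hLb hpush).τ 0)) 1
      (hostSchedule L Lb hL hLb hpush).f (vel L Lb) (pres L) := by
    rw [hτ0]
    exact isClassicalNSSolutionOn_vel hL0 hLb0
  refine ⟨{ u := vel L Lb, p := pres L, classical := hcl, initial := ?_, energy := henergy,
            floor := ?_, ceiling := ?_, quiet := ?_, margin := ?_ }⟩
  · rw [vel_zero]; rfl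
  · intro j hj
    obtain rfl := Nat.le_zero.1 hj
    refine ⟨center L Lb + Lb • thetaArgmax, norm_floorPoint_le hL0.le hLb0, ?_⟩
    rw [hτ0, hostSchedule_c₁, one_mul, norm_vel_floorPoint hL0 hLb0]
  · intro j hj t _ x
    obtain rfl := Nat.le_zero.1 hj
    rw [hostSchedule_c₂]
    have := norm_vel_le hL0 hLb0 hslab t x
    have := wide_Y_zero_pos
    linarith
  · intro j hj
    exact absurd hj (by omega)
  · show (∀ j, j ≤ 0 → ∃ x, ‖x‖ ≤ (hostSchedule L Lb hL hLb hpush).radius ∧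
        (hostSchedule L Lb hL hLb hpush).c₁ * TowerRates.wide.A j ≤ ‖fderiv ℝ (vel L Lb
          ((hostSchedule L Lb hL hLb hpush).τ j)) x‖) ∧
      ((hostSchedule L Lb hL hLb hpush).AnchorGlobal (vel L Lb) ∧
        ((hostSchedule L Lb hL hLb hpush).Rigid ∧
          CoreLedger TowerRates.wide (hostSchedule L Lb hL hLb hpush) 0 (vel L Lb)))
    refine ⟨?_, ?_, hostSchedule_rigid hL hLb hpush, ?_⟩
    · intro j hj
      obtain rfl := Nat.le_zero.1 hj
      refine ⟨0, by rw [norm_zero, hrad]; exact hrad0, ?_⟩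
      rw [hτ0, hostSchedule_c₁, one_mul]
      exact strain_vel hL hLb
    · intro t ht x
      rw [hτ0] at ht
      rw [hostSchedule_c₁, one_mul]
      exact norm_vel_lt hL0 hLb0 hslab ht.2 x
    · intro j hj
      obtain rfl := Nat.le_zero.1 hj
      refine ⟨0, loop, by rw [norm_zero, hrad]; exact hrad0, contDiff_loop, loop_zero_eq_one,
        fun s _ => loop_mem_closedBall s, fun s _ => norm_deriv_loop_le s, ?_⟩
      rw [hτ0, hostSchedule_c₁, one_mul]
      exact rpow_le_circulation hL hLb

/-! ## §3 The choice of scales and the theorem -/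

/-- `‖a × b‖ ≤ ‖a‖ ‖b‖` (a private copy of `norm_cross_le` of `PoincareHomotopyOperatorL2`, not
imported to keep the closure small). [folklore] -/
private theorem norm_cross_le' (a b : ℝ³) : ‖cross a b‖ ≤ ‖a‖ * ‖b‖ := by
  rw [norm_cross]
  exact mul_le_of_le_one_right (by positivity) (Real.sin_le_one _)

/-- **The residual after `t = 1`** (bump static, slab decaying exactly): its size is controlled by
the cut-off-scale bounds of the packet and the bump. [folklore] -/
theorem norm_resid_le {L Lb : ℝ} {t : ℝ} (ht : 1 ≤ t) (x : ℝ³) :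
    ‖resid L Lb t x‖ ≤
      ampBump ^ 2 * ‖convect (bumpF L Lb) (bumpF L Lb) x‖ + ampBump * ‖curl (curl (bumpF L Lb)) x‖ +
        ampSlab ^ 2 * (‖slabDefect L x‖ * ‖slab L x‖) +
        ampSlab * (freq * ‖slabDefect L x‖ + ‖curl (slabDefect L) x‖) := by
  have ha := aProf_of_one_le ht
  have ha' := deriv_aProf_of_one_le ht
  have hb' := deriv_bProf_add ht
  have hb0 := bProf_nonneg (t := t)
  have hb1 := bProf_le_amp ht
  unfold resid
  rw [ha, ha', hb', zero_smul, zero_add, zero_smul, add_zero]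
  refine (norm_add_le _ _).trans (add_le_add ((norm_add_le _ _).trans (add_le_add
    ((norm_add_le _ _).trans (add_le_add ?_ ?_)) ?_)) ?_)
  · rw [norm_smul, Real.norm_eq_abs, abs_of_nonneg (sq_nonneg _)]
  · rw [norm_smul, Real.norm_eq_abs, abs_of_pos ampBump_pos]
  · rw [norm_smul, Real.norm_eq_abs, abs_of_nonneg (sq_nonneg _)]
    exact mul_le_mul (pow_le_pow_left₀ hb0 hb1 2) (norm_cross_le' _ _) (norm_nonneg _) (sq_nonneg _)
  · rw [norm_smul, Real.norm_eq_abs, abs_of_nonneg hb0]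
    refine mul_le_mul hb1 ((norm_add_le _ _).trans (add_le_add ?_ le_rfl)) (norm_nonneg _)
      ampSlab_pos.le
    rw [norm_smul, Real.norm_eq_abs, abs_of_pos freq_pos]

/-- **Choice of the scales.** With the packet bounds (`PalasekTowerHostCutoff.packet_scale_bounds`)
and the bump bounds (`PalasekTowerHostBump.bump_scale_bounds`) — all `≤ K/L` — large cut-off
scales make the slab speed `≤ (11/10)λ` and the residual `≤ Y₀/200` from `t = 1` on. [folklore] -/
theorem exists_scales : ∃ L Lb : ℝ, 1 ≤ L ∧ 1 ≤ Lb ∧ (∀ x : ℝ³, ‖slab L x‖ ≤ 11 / 10 * freq) ∧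
    ∀ t : ℝ, 1 ≤ t → ∀ x : ℝ³, ‖resid L Lb t x‖ ≤ 1 / 200 * TowerRates.wide.Y 0 := by
  obtain ⟨Kp, hKp0, hKp⟩ := packet_scale_bounds freq
  obtain ⟨Cb, hCb0, hCb⟩ := bump_scale_bounds
  have hY := wide_Y_zero_pos
  have hf := freq_pos
  have ha := ampBump_pos
  have hb := ampSlab_pos
  -- the slab-side and bump-side constants
  set Ks : ℝ := ampSlab ^ 2 * (Kp * (freq + Kp)) + ampSlab * (freq * Kp + Kp) with hKs
  set Kb : ℝ := ampBump ^ 2 * Cb + ampBump * Cb with hKb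
  have hKs0 : 0 ≤ Ks := by positivity
  have hKb0 : 0 ≤ Kb := by positivity
  set L : ℝ := max 1 (max (10 * Kp / freq) (400 * Ks / TowerRates.wide.Y 0)) with hLdef
  set Lb : ℝ := max 1 (400 * Kb / TowerRates.wide.Y 0) with hLbdef
  have hL1 : 1 ≤ L := le_max_left _ _
  have hLb1 : 1 ≤ Lb := le_max_left _ _
  have hL0 : 0 < L := by linarith
  have hLb0 : 0 < Lb := by linarith
  have hKpL : Kp / L ≤ freq / 10 := by
    rw [div_le_iff₀ hL0]
    have : 10 * Kp / freq ≤ L := le_trans (le_max_left _ _) (le_max_right _ _)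
    rw [div_le_iff₀ hf] at this
    linarith
  have hKpL' : Kp / L ≤ Kp := div_le_self hKp0 hL1
  have hKsL : Ks / L ≤ TowerRates.wide.Y 0 / 400 := by
    rw [div_le_iff₀ hL0]
    have : 400 * Ks / TowerRates.wide.Y 0 ≤ L := le_trans (le_max_right _ _) (le_max_right _ _)
    rw [div_le_iff₀ hY] at this
    linarith
  have hKbL : Kb / Lb ≤ TowerRates.wide.Y 0 / 400 := by
    rw [div_le_iff₀ hLb0]
    have : 400 * Kb / TowerRates.wide.Y 0 ≤ Lb := le_max_right _ _
    rw [div_le_iff₀ hY] at this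
    linarith
  refine ⟨L, Lb, hL1, hLb1, fun x => ?_, fun t ht x => ?_⟩
  · obtain ⟨h1, -, -, -⟩ := hKp L hL1 x
    rw [abs_of_pos hf] at h1
    exact h1.trans (by linarith)
  · obtain ⟨h1, -, h3, h4⟩ := hKp L hL1 x
    obtain ⟨h5, h6⟩ := hCb (center L Lb) Lb hLb1 x
    rw [abs_of_pos hf] at h1
    have hs : ‖slab L x‖ ≤ freq + Kp := h1.trans (by linarith)
    refine (norm_resid_le ht x).trans ?_
    have hbump : ampBump ^ 2 * ‖convect (bumpF L Lb) (bumpF L Lb) x‖ +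
        ampBump * ‖curl (curl (bumpF L Lb)) x‖ ≤ Kb / Lb := by
      rw [hKb, add_div]
      refine add_le_add ?_ ?_
      · rw [mul_div_assoc]; exact mul_le_mul_of_nonneg_left h5 (sq_nonneg _)
      · rw [mul_div_assoc]; exact mul_le_mul_of_nonneg_left h6 ha.le
    have hslab : ampSlab ^ 2 * (‖slabDefect L x‖ * ‖slab L x‖) +
        ampSlab * (freq * ‖slabDefect L x‖ + ‖curl (slabDefect L) x‖) ≤ Ks / L := by
      rw [hKs, add_div]
      refine add_le_add ?_ ?_
      · rw [mul_div_assoc]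
        refine mul_le_mul_of_nonneg_left ?_ (sq_nonneg _)
        calc ‖slabDefect L x‖ * ‖slab L x‖ ≤ (Kp / L) * (freq + Kp) :=
              mul_le_mul h3 hs (norm_nonneg _) (div_nonneg hKp0 hL0.le)
          _ = Kp * (freq + Kp) / L := by ring
      · rw [mul_div_assoc]
        refine mul_le_mul_of_nonneg_left ?_ hb.le
        calc freq * ‖slabDefect L x‖ + ‖curl (slabDefect L) x‖ ≤ freq * (Kp / L) + Kp / L :=
              add_le_add (mul_le_mul_of_nonneg_left h3 hf.le) h4
          _ = (freq * Kp + Kp) / L := by ring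
    linarith

/-- **HOST PREPARATION — the BC3 stub `host_preparation` of the crux `EpisodeBaseG`
(item stmt-NavierStokesRegularity-19179) is inhabited**: some pinned (`Λ = 8`, `θ = 6/5`), rigid,
quiet schedule on the wide-base rates carries a globally anchored, strained, cored stage at level
`0` at unit viscosity (`RungG 0` of `PalasekTowerRegisterGlobalTail`). The witness is the prescribed
host of this series (force free before `τ₀`); it is junk with respect to heredity and says nothing
about `EpisodeBaseG = RungG 1`. [cite: Palasek2026ElementaryModel, §4] -/
theorem rungG_zero : RungG 0 := by
  obtain ⟨L, Lb, hL, hLb, hslab, hres⟩ := exists_scales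
  have hpush : ∀ t ∈ Icc (1 : ℝ) τfirst, ∀ x : ℝ³,
      ‖resid L Lb t x‖ ≤ 1 / 200 * TowerRates.wide.Y 0 := fun t ht x => hres t ht.1 x
  exact ⟨hostSchedule L Lb hL hLb hpush, hostSchedule_pins hL hLb hpush,
    hostSchedule_rigid hL hLb hpush, hostSchedule_quiet hL hLb hpush,
    stage_of_scales hL hLb hslab hpush⟩

/-- **The named stub `HostPreparation` of `PalasekTowerRegisterGlobalBase` (= `RungG 0`
definitionally, `hostPreparation_iff_rungG_zero`) holds.** [cite: Palasek2026ElementaryModel, §4] -/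
theorem hostPreparation : HostPreparation := rungG_zero

/-- **The crux's cone shrinks to its other stub**: `FirstEpisode → EpisodeBaseG` (the base skeleton's
composition `episodeBaseG_of_host_first` with its first hypothesis discharged). HONEST NOTE:
`FirstEpisode = HeredityAt 0` quantifies over ALL level-`0` stages, including the junk host of this
file, whose designed continuation decays. [cite: Palasek2026ElementaryModel, §4] -/
theorem episodeBaseG_of_firstEpisode (h : FirstEpisode) : EpisodeBaseG :=
  episodeBaseG_of_host_first hostPreparation h

/-- **… or to a heredity WITNESS at level `0`** (ecbridge-6's typed numerical-witness hypothesis,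
`PalasekTowerHeredityWitnessRungs.episodeBaseG_of_rungG_zero_of_heredityWitness`), given the forced
unconditional uniqueness `hU`. [cite: Tao2011, Cor. 11.4] -/
theorem episodeBaseG_of_heredityWitness_zero (hU : tao_unconditional_uniqueness_velocity_forced)
    (h : HeredityWitness 0) : EpisodeBaseG :=
  episodeBaseG_of_rungG_zero_of_heredityWitness hU rungG_zero h

end Summit.NavierStokesRegularity.FluidComputer.PalasekTowerClayBridge.Host

end
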